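import Summits.BirchSwinnertonDyer.BirchSwinnertonDyer.Theorems.PrintCf2SplitBadTwoRestrictedSelmerPairSkeleton
import Literature.NumberTheory.EllipticCurves.FineSelmerCoefficientMapProofs
import Literature.NumberTheory.EllipticCurves.EndomorphismEigenPrimaryTorsion
import HarnessLib

/-!
# Crux `PrintCf2.SplitBadTwoRankOneOfFacts` (stmt-BirchSwinnertonDyer-20368), road α — brick B5 (file 2 of 2):
# the restricted-Selmer PAIR at the BOTTOM `L = K`, functoriality in the coefficients, and the CM instance by name

Cell `bsd-print-cf2`, width seat `bsd-line-cf2-p1-w7` g0; `--supports stmt-BirchSwinnertonDyer-20368` (helper,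
Theses-free). HONEST FRAMING: nothing here closes a crux or a stub; BSD is not proved by any of this; no summit
statement is proved by this seat. No definition, no named fact, no `sorry`. Continues
`Theorems/PrintCf2SplitBadTwoRestrictedSelmerPairSkeleton.lean` (§§0–3: the pair `𝔖_v`, `𝔖_v̄` of Agboola's
restricted Selmer groups in `H¹(H, M)`, the doubly-strict group, the local terms `Λ_v = ∏_σ loc_v ∘ conj_σ` as
restriction maps, the cardinality identities, Greenberg's `Sel(L, M)` for `bdpData`).

* §4 the BOTTOM `H = ⊤`, `L = K` (`Agboola2007.restrictedSelmerBase`; Agboola §6 "Restricted Selmer groups over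
  `K`"): inner conjugations act trivially on `H¹` (`conjH1_of_mem`, Serre VII §5 Prop. 3), so every `∏_σ` collapses
  to the single chosen place and the local term at `v` is the ONE restriction `loc_v : H¹(K, M) → H¹(D_v, M)` —
  `mem_restrictedSelmerBase_iff_resOfLe`, `restrictedSelmerBase_inf_eq`, `ker_resOfLe_comp_subtype_base`,
  `card_restrictedSelmerBase_eq` (`#𝔖_v̄(K) = #(𝔖_v(K) ⊓ 𝔖_v̄(K)) · #loc_v(𝔖_v̄(K))`), `card_mul_card_base_comm`
  (`#𝔖_v̄ · #loc_v̄(𝔖_v) = #𝔖_v · #loc_v(𝔖_v̄)`), `selmerGroupOverBase_inf_eq_restrictedSelmerBase`,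
  `resOfLe_inertia_eq_zero_of_mem_selmerGroupOverBase` (unramified local term), `card_selmerGroupOverBase_eq`;
* §5 FUNCTORIALITY IN THE COEFFICIENTS (`resH1Hom_id_mem_restrictedSelmer`): a `Γ_K`-equivariant `ψ : M → M′`
  maps `𝔖_𝔮(L, M)` into `𝔖_𝔮(L, M′)`; for the inclusion of the `Γ_K`-stable CM summand
  `W* = V.endEigenPrimaryTorsion p π r ≤ E[p^∞]` (p646843) this puts `𝔖_𝔮(L, W*)` inside
  `𝔖_𝔮(L, E[p^∞]) ⊆ H¹(H, E[p^∞]) = V.subgroupH1 p H`, the home of the classical Selmer group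
  `WeierstrassCurve.selmerGroupOver V p H` (`subtype_mem_restrictedSelmer_geomPrimaryTorsion`);
* §6 the CM specialisation BY NAME at the bottom, `M = ↥((W.baseChange L).endEigenPrimaryTorsion 2 π r)`, `p = 2`:
  `card_restrictedSelmerBase_endEigenPrimaryTorsion_eq`, `card_mul_card_endEigenPrimaryTorsion_comm` — road α's
  bottom pair `𝔖_{𝔭₀}(K₀, W*)` (Greenberg shape of the classical group) / `𝔖_{𝔭̄₀}(K₀, W*)` (Agboola's reversed
  group, S3b's bottom object) and their two local terms at `𝔭₀`, `𝔭̄₀`, well-typed on the named module.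

NOT PROVED HERE (as in file 1): the Kummer identification with the classical Selmer group of `W/K₀` (local Kummer
theory at the additive `2`, bricks B2/B7) and the values of the local terms / Poitou–Tate (Agboola Thm. 2, Prop. 8.1).

References: A. Agboola, Compositio Math. 143 (2007) = arXiv:math/0602192, §1 p. 2, §3, §6 [Agboola2007]; R. Greenberg,
Adv. Stud. Pure Math. 17 (1989) §1 p. 98 [Greenberg1989]; J.-P. Serre, *Local Fields*, VII §5 Prop. 3
[SerreLocalFields1979]; J. Neukirch, A. Schmidt, K. Wingberg, *Cohomology of Number Fields* (2008) I §5–6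
[NeukirchSchmidtWingberg2008]; K. Rubin, LNM 1716 (1999) §2, Prop. 5.4 [Rubin1999].
-/


noncomputable section

open scoped Classical

set_option linter.dupNamespace false
set_option autoImplicit false

open NumberField IsDedekindDomain Field
open Literature.NumberTheory.EllipticCurves Literature.NumberTheory.EllipticCurves.GreenbergSelmer
open Literature.NumberTheory.EllipticCurves.Castella2018.AcSelmer
open Literature.NumberTheory.EllipticCurves.Agboola2007
open Literature.NumberTheory.GaloisRepresentations

universe u

namespace Summit.BirchSwinnertonDyer.BirchSwinnertonDyer.Theorems.PrintCf2.RestrictedSelmerPair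

/-! ## §4. The bottom of the descent: `L = K`, `H = ⊤` (`Agboola2007.restrictedSelmerBase`) -/

section Base

variable {K : Type u} [Field K] [NumberField K] (M : Type u) [AddCommGroup M]
  [DistribMulAction (absoluteGaloisGroup K) M] [TopologicalSpace M] [DiscreteTopology M]
  (p : ℕ) (v vbar : HeightOneSpectrum (𝓞 K))

omit [NumberField K] in
/-- **Inner conjugations act trivially at the bottom**: `conj_σ = id` on `H¹(Γ_K, M)` for every `σ ∈ Γ_K`
(`conjH1_of_mem`, Serre). [cite: SerreLocalFields1979, VII.§5 Prop. 3] -/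
theorem conjH1_top (σ : absoluteGaloisGroup K) :
    conjH1 (⊤ : Subgroup (absoluteGaloisGroup K)) M σ = AddMonoidHom.id _ :=
  conjH1_of_mem_holds ⊤ M (Subgroup.mem_top σ)

/-- **Membership in `𝔖_𝔮(K, M)` over the base field, `σ`-free and as vanishing restrictions**: `c ∈ 𝔖_𝔮(K, M)` iff
`c` restricts to zero on `D_w` for every finite `w ∤ p`, on `D_w` for every infinite `w`, and on `D_𝔮` (Agboola §6,
"Restricted Selmer groups over `K`"). [cite: Agboola2007, §3 (arXiv p0008:L58–64), §6 (p0013:L1–4)] -/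
theorem mem_restrictedSelmerBase_iff_resOfLe (𝔮 : HeightOneSpectrum (𝓞 K))
    (c : subgroupH1 (⊤ : Subgroup (absoluteGaloisGroup K)) M) :
    c ∈ restrictedSelmerBase M p 𝔮 ↔
      (∀ w : HeightOneSpectrum (𝓞 K), ((p : ℕ) : 𝓞 K) ∉ w.asIdeal →
          resOfLe M (inf_le_left : ⊤ ⊓ decomp w ≤ ⊤) c = 0) ∧
        (∀ w : InfinitePlace K, resOfLe M (inf_le_left : ⊤ ⊓ decompInf w ≤ ⊤) c = 0) ∧
        resOfLe M (inf_le_left : ⊤ ⊓ decomp 𝔮 ≤ ⊤) c = 0 := by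
  show c ∈ restrictedSelmer ⊤ M p 𝔮 ↔ _
  rw [mem_restrictedSelmer_iff_resOfLe]
  simp only [conjH1_top, AddMonoidHom.id_apply, forall_const]

/-- **At the bottom the doubly-strict group is `𝔖_v̄(K, M) ⊓ ker loc_v`** (one chosen place, no conjugates).
[cite: Agboola2007, §3 (arXiv p0008:L50–68), §6] -/
theorem restrictedSelmerBase_inf_eq :
    restrictedSelmerBase M p vbar ⊓ restrictedSelmerBase M p v =
      restrictedSelmerBase M p vbar ⊓ awayKer ⊤ M v := by
  ext c
  simp only [AddSubgroup.mem_inf, mem_restrictedSelmerBase_iff_resOfLe, awayKer, AddMonoidHom.mem_ker]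
  constructor
  · rintro ⟨hbar, -, -, hv⟩
    exact ⟨hbar, hv⟩
  · rintro ⟨hbar, hv⟩
    exact ⟨hbar, hbar.1, hbar.2.1, hv⟩

/-- **At the bottom the local term at `v` is the single restriction `loc_v : H¹(K, M) → H¹(D_v, M)`; on `𝔖_v̄(K, M)`
its kernel is exactly `𝔖_v(K, M) ⊓ 𝔖_v̄(K, M)`** (so `𝔖_v̄ ⧸ (𝔖_v ⊓ 𝔖_v̄) ↪ H¹(D_v, M) = H¹(K_v, M)`).
[cite: Agboola2007, §3, §6 (arXiv p0013:L1–4)] [cite: NeukirchSchmidtWingberg2008, I.§5] -/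
theorem ker_resOfLe_comp_subtype_base :
    ((resOfLe M (inf_le_left : ⊤ ⊓ decomp v ≤ ⊤)).comp (restrictedSelmerBase M p vbar).subtype).ker =
      (restrictedSelmerBase M p v ⊓ restrictedSelmerBase M p vbar).addSubgroupOf
        (restrictedSelmerBase M p vbar) := by
  ext c
  rw [AddMonoidHom.mem_ker, AddMonoidHom.comp_apply, AddSubgroup.mem_addSubgroupOf,
    inf_comm (a := restrictedSelmerBase M p v) (b := restrictedSelmerBase M p vbar),
    restrictedSelmerBase_inf_eq, AddSubgroup.mem_inf, AddSubgroup.coe_subtype, awayKer,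
    AddMonoidHom.mem_ker]
  exact ⟨fun h ↦ ⟨c.2, h⟩, fun h ↦ h.2⟩

/-- **`#𝔖_v̄(K, M) = #(𝔖_v(K, M) ⊓ 𝔖_v̄(K, M)) · #loc_v(𝔖_v̄(K, M))`** — at the bottom the local term at `v` is the
image of Agboola's reversed group in the single local group `H¹(D_v, M)`.
[cite: Agboola2007, §6 (arXiv p0013:L1–4), §3] -/
theorem card_restrictedSelmerBase_eq :
    Nat.card (restrictedSelmerBase M p vbar) =
      Nat.card ↥(restrictedSelmerBase M p v ⊓ restrictedSelmerBase M p vbar) *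
        Nat.card ((resOfLe M (inf_le_left : ⊤ ⊓ decomp v ≤ ⊤)).comp
          (restrictedSelmerBase M p vbar).subtype).range := by
  set f := (resOfLe M (inf_le_left : ⊤ ⊓ decomp v ≤ ⊤)).comp (restrictedSelmerBase M p vbar).subtype
    with hf
  rw [AddSubgroup.card_eq_card_quotient_mul_card_addSubgroup f.ker,
    Nat.card_congr (QuotientAddGroup.quotientKerEquivRange f).toEquiv, hf,
    ker_resOfLe_comp_subtype_base,
    Nat.card_congr (AddSubgroup.addSubgroupOfEquivOfLe
      (inf_le_right : restrictedSelmerBase M p v ⊓ restrictedSelmerBase M p vbar ≤ _)).toEquiv,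
    mul_comm]

/-- **The comparison identity at the bottom**: `#𝔖_v̄(K, M) · #loc_v̄(𝔖_v(K, M)) = #𝔖_v(K, M) · #loc_v(𝔖_v̄(K, M))`.
For `M = W*`, `v = 𝔭`, `v̄ = 𝔭*`: the order of Agboola's `𝔖_{𝔭*}(K, W*)` is that of the Greenberg-shaped
`𝔖_𝔭(K, W*)` corrected by the two local terms — the skeleton of the bottom bookkeeping of road α's S3b.
[cite: Agboola2007, §1 p. 2 (arXiv p0004:L5–9), §6] -/
theorem card_mul_card_base_comm :
    Nat.card (restrictedSelmerBase M p vbar) *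
        Nat.card ((resOfLe M (inf_le_left : ⊤ ⊓ decomp vbar ≤ ⊤)).comp
          (restrictedSelmerBase M p v).subtype).range =
      Nat.card (restrictedSelmerBase M p v) *
        Nat.card ((resOfLe M (inf_le_left : ⊤ ⊓ decomp v ≤ ⊤)).comp
          (restrictedSelmerBase M p vbar).subtype).range := by
  rw [card_restrictedSelmerBase_eq M p v vbar, card_restrictedSelmerBase_eq M p vbar v,
    inf_comm (a := restrictedSelmerBase M p vbar) (b := restrictedSelmerBase M p v)]
  ring

/-- **Greenberg's `Sel(K, M)` (data `bdpData M p v`) cut by `ker loc_v` is `𝔖_v(K, M)`** (bottom, one place).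
[cite: Greenberg1989, §1 p. 98] [cite: Agboola2007, §6] -/
theorem selmerGroupOverBase_inf_eq_restrictedSelmerBase (hv : ((p : ℕ) : 𝓞 K) ∈ v.asIdeal) :
    selmerGroupOver ⊤ M p (bdpData M p v) ⊓ awayKer ⊤ M v = restrictedSelmerBase M p v := by
  show _ = restrictedSelmer ⊤ M p v
  rw [← selmerGroupOver_bdpData_inf_eq_restrictedSelmer ⊤ M p v hv]
  congr 1
  ext c
  simp only [AddSubgroup.mem_iInf, AddSubgroup.mem_comap, conjH1_top, AddMonoidHom.id_apply,
    forall_const]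

/-- **At the bottom, `loc_v` of a class of `Sel(K, M)` is unramified**: it restricts to zero on `I_v`.
[cite: Greenberg1989, §1 p. 98 (4)] -/
theorem resOfLe_inertia_eq_zero_of_mem_selmerGroupOverBase (hv : ((p : ℕ) : 𝓞 K) ∈ v.asIdeal)
    {c : subgroupH1 (⊤ : Subgroup (absoluteGaloisGroup K)) M}
    (hc : c ∈ selmerGroupOver ⊤ M p (bdpData M p v)) :
    resOfLe M (inf_le_inf_left ⊤ (inertia_le_decomp v) : ⊤ ⊓ inertia v ≤ ⊤ ⊓ decomp v)
        (resOfLe M (inf_le_left : ⊤ ⊓ decomp v ≤ ⊤) c) = 0 := by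
  have h := resOfLe_inertia_conjH1_eq_zero_of_mem_selmerGroupOver ⊤ M p v hv hc 1
  rwa [conjH1_top, AddMonoidHom.id_apply] at h

/-- **`#Sel(K, M) = #𝔖_v(K, M) · #loc_v(Sel(K, M))`** at the bottom (data `bdpData M p v`), the image lying in the
unramified classes of `H¹(D_v, M)`. [cite: Greenberg1989, §1 p. 98] [cite: Agboola2007, §6] -/
theorem card_selmerGroupOverBase_eq (hv : ((p : ℕ) : 𝓞 K) ∈ v.asIdeal) :
    Nat.card (selmerGroupOver ⊤ M p (bdpData M p v)) =
      Nat.card (restrictedSelmerBase M p v) *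
        Nat.card ((resOfLe M (inf_le_left : ⊤ ⊓ decomp v ≤ ⊤)).comp
          (selmerGroupOver ⊤ M p (bdpData M p v)).subtype).range := by
  set f := (resOfLe M (inf_le_left : ⊤ ⊓ decomp v ≤ ⊤)).comp
    (selmerGroupOver ⊤ M p (bdpData M p v)).subtype with hf
  have hker : f.ker =
      (restrictedSelmerBase M p v).addSubgroupOf (selmerGroupOver ⊤ M p (bdpData M p v)) := by
    ext c
    rw [AddMonoidHom.mem_ker, hf, AddMonoidHom.comp_apply, AddSubgroup.mem_addSubgroupOf,
      ← selmerGroupOverBase_inf_eq_restrictedSelmerBase M p v hv, AddSubgroup.mem_inf,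
      AddSubgroup.coe_subtype, awayKer, AddMonoidHom.mem_ker]
    exact ⟨fun h ↦ ⟨c.2, h⟩, fun h ↦ h.2⟩
  rw [AddSubgroup.card_eq_card_quotient_mul_card_addSubgroup f.ker,
    Nat.card_congr (QuotientAddGroup.quotientKerEquivRange f).toEquiv, hker,
    Nat.card_congr (AddSubgroup.addSubgroupOfEquivOfLe
      (restrictedSelmer_le_selmerGroupOver_bdpData ⊤ M p v hv)).toEquiv,
    mul_comm]

end Base

/-! ## §5. Functoriality in the coefficient module: `𝔖_𝔮(L, M) → 𝔖_𝔮(L, M′)`; `W* ↪ E[p^∞]` -/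

section Functorial

variable {K : Type u} [Field K] [NumberField K]
  (H : Subgroup (absoluteGaloisGroup K)) [H.Normal]
  {M : Type u} [AddCommGroup M] [DistribMulAction (absoluteGaloisGroup K) M]
  [TopologicalSpace M] [DiscreteTopology M]
  {M' : Type u} [AddCommGroup M'] [DistribMulAction (absoluteGaloisGroup K) M']
  [TopologicalSpace M'] [DiscreteTopology M']
  (p : ℕ) (𝔮 : HeightOneSpectrum (𝓞 K))

/-- **A `Γ_K`-equivariant map of coefficients `ψ : M → M′` maps `𝔖_𝔮(L, M)` into `𝔖_𝔮(L, M′)`**: every condition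
of `𝔖_𝔮` is "a restriction of a conjugate vanishes" (`mem_restrictedSelmer_iff_resOfLe`) and `ψ_*` commutes with
conjugation and restriction (`FineSelmerCoefficientMap.conjH1_comp_resH1Hom_id`, `.resOfLe_comp_resH1Hom_id`).
[cite: NeukirchSchmidtWingberg2008, I.§5] [cite: Agboola2007, §3 (arXiv p0008:L58–68)] -/
theorem resH1Hom_id_mem_restrictedSelmer (ψ : M →+ M')
    (hψ' : ∀ (g : absoluteGaloisGroup K) (m : M), ψ (g • m) = g • ψ m)
    (hψ : ∀ (x : H) (m : M), ψ (ContinuousMonoidHom.id H x • m) = x • ψ m)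
    {c : subgroupH1 H M} (hc : c ∈ restrictedSelmer H M p 𝔮) :
    resH1Hom (ContinuousMonoidHom.id H) ψ hψ c ∈ restrictedSelmer H M' p 𝔮 := by
  rw [mem_restrictedSelmer_iff_resOfLe] at hc ⊢
  have hconj : ∀ σ : absoluteGaloisGroup K,
      conjH1 H M' σ (resH1Hom (ContinuousMonoidHom.id H) ψ hψ c) =
        resH1Hom (ContinuousMonoidHom.id H) ψ hψ (conjH1 H M σ c) :=
    fun σ ↦ congrArg (fun f : subgroupH1 H M →+ subgroupH1 H M' ↦ f c)
      (FineSelmerCoefficientMap.conjH1_comp_resH1Hom_id H ψ hψ hψ' σ)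
  have hres : ∀ (H₁ : Subgroup (absoluteGaloisGroup K)) (hle : H₁ ≤ H) (x : subgroupH1 H M),
      resOfLe M' hle (resH1Hom (ContinuousMonoidHom.id H) ψ hψ x) =
        resH1Hom (ContinuousMonoidHom.id H₁) ψ (fun y m ↦ hψ' y m) (resOfLe M hle x) := by
    intro H₁ hle x
    have e := congrArg (fun f : subgroupH1 H M →+ subgroupH1 H₁ M' ↦ f x)
      (FineSelmerCoefficientMap.resOfLe_comp_resH1Hom_id hle ψ hψ (fun y m ↦ hψ' y m))
    simpa only [AddMonoidHom.comp_apply] using e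
  refine ⟨fun w hw σ ↦ ?_, fun w σ ↦ ?_, fun σ ↦ ?_⟩
  · rw [hconj, hres, hc.1 w hw σ, map_zero]
  · rw [hconj, hres, hc.2.1 w σ, map_zero]
  · rw [hconj, hres, hc.2.2 σ, map_zero]

/-- **`𝔖_𝔮(L, W*) → 𝔖_𝔮(L, E[p^∞])` for the CM summand `W* = V.endEigenPrimaryTorsion p π r ≤ E[p^∞]`**: the
inclusion of the `Γ_K`-stable eigen-subgroup (p646843) pushes Agboola's restricted Selmer group of the summand into
the restricted Selmer group with coefficients `E[p^∞] = V.geomPrimaryTorsion p`, a subgroup of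
`H¹(H, E[p^∞]) = V.subgroupH1 p H` — the group in which the classical Selmer group
`WeierstrassCurve.selmerGroupOver V p H` of `E/L` lives (their comparison is local Kummer theory, not done here).
[cite: Rubin1999, §2 and Prop. 5.4] [cite: Agboola2007, §3 (arXiv p0008:L5–20)] -/
theorem subtype_mem_restrictedSelmer_geomPrimaryTorsion (V : WeierstrassCurve K) [Fact p.Prime]
    (π : V.endRing) (r : ℤ_[p]) {c : subgroupH1 H ↥(V.endEigenPrimaryTorsion p π r)}
    (hc : c ∈ restrictedSelmer H ↥(V.endEigenPrimaryTorsion p π r) p 𝔮) :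
    resH1Hom (ContinuousMonoidHom.id H) (V.endEigenPrimaryTorsion p π r).subtype (fun _ _ ↦ rfl) c ∈
      restrictedSelmer H (V.geomPrimaryTorsion p) p 𝔮 :=
  resH1Hom_id_mem_restrictedSelmer H p 𝔮 (V.endEigenPrimaryTorsion p π r).subtype (fun _ _ ↦ rfl)
    (fun _ _ ↦ rfl) hc

end Functorial

/-! ## §6. The CM specialisation BY NAME at the bottom: `M = E[𝔮^∞] = (W.baseChange L).endEigenPrimaryTorsion 2 π r` -/

section CM

variable (W : WeierstrassCurve ℚ) (L : Type) [Field L] [NumberField L]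
  (π : (W.baseChange L).endRing) (r : ℤ_[2]) (𝔭 𝔭bar : HeightOneSpectrum (𝓞 L))

/-- **Road α's bottom pair, by name.** For `W/ℚ`, a number field `L` (intended `K₀ = ℚ(√−7)`, `2 = 𝔭𝔭̄`), a
`K`-rational `π ∈ End_L(E_L)` and a `2`-adic `r` (intended `π² = π − 2`, `r` the root at `𝔭̄`, so that
`M := E[𝔭̄^∞] = W*`): `#𝔖_{𝔭̄}(L, M) = #(𝔖_𝔭(L, M) ⊓ 𝔖_{𝔭̄}(L, M)) · #loc_𝔭(𝔖_{𝔭̄}(L, M))` — the instance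
`card_restrictedSelmerBase_eq` on the named module of p646843 (well-formed: additive group, `Γ_L`-action, discrete).
[cite: Agboola2007, §6 (arXiv p0013:L1–4)] [cite: Rubin1999, §2 and Prop. 5.4] -/
theorem card_restrictedSelmerBase_endEigenPrimaryTorsion_eq :
    Nat.card (restrictedSelmerBase ↥((W.baseChange L).endEigenPrimaryTorsion 2 π r) 2 𝔭bar) =
      Nat.card ↥(restrictedSelmerBase ↥((W.baseChange L).endEigenPrimaryTorsion 2 π r) 2 𝔭 ⊓
          restrictedSelmerBase ↥((W.baseChange L).endEigenPrimaryTorsion 2 π r) 2 𝔭bar) *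
        Nat.card ((resOfLe ↥((W.baseChange L).endEigenPrimaryTorsion 2 π r)
            (inf_le_left : ⊤ ⊓ decomp 𝔭 ≤ ⊤)).comp
          (restrictedSelmerBase ↥((W.baseChange L).endEigenPrimaryTorsion 2 π r) 2 𝔭bar).subtype).range :=
  card_restrictedSelmerBase_eq _ 2 𝔭 𝔭bar

/-- **The comparison identity for road α's bottom pair, by name**:
`#𝔖_{𝔭̄}(L, M) · #loc_{𝔭̄}(𝔖_𝔭(L, M)) = #𝔖_𝔭(L, M) · #loc_𝔭(𝔖_{𝔭̄}(L, M))` for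
`M = ↥((W.baseChange L).endEigenPrimaryTorsion 2 π r)`. [cite: Agboola2007, §1 p. 2 (arXiv p0004:L5–9), §6] -/
theorem card_mul_card_endEigenPrimaryTorsion_comm :
    Nat.card (restrictedSelmerBase ↥((W.baseChange L).endEigenPrimaryTorsion 2 π r) 2 𝔭bar) *
        Nat.card ((resOfLe ↥((W.baseChange L).endEigenPrimaryTorsion 2 π r)
            (inf_le_left : ⊤ ⊓ decomp 𝔭bar ≤ ⊤)).comp
          (restrictedSelmerBase ↥((W.baseChange L).endEigenPrimaryTorsion 2 π r) 2 𝔭).subtype).range =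
      Nat.card (restrictedSelmerBase ↥((W.baseChange L).endEigenPrimaryTorsion 2 π r) 2 𝔭) *
        Nat.card ((resOfLe ↥((W.baseChange L).endEigenPrimaryTorsion 2 π r)
            (inf_le_left : ⊤ ⊓ decomp 𝔭 ≤ ⊤)).comp
          (restrictedSelmerBase ↥((W.baseChange L).endEigenPrimaryTorsion 2 π r) 2 𝔭bar).subtype).range :=
  card_mul_card_base_comm _ 2 𝔭 𝔭bar

end CM

end Summit.BirchSwinnertonDyer.BirchSwinnertonDyer.Theorems.PrintCf2.RestrictedSelmerPair

end
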